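import Summits.MatrixMultiplication.OmegaCensus.C2Quaternion40Law
import Summits.MatrixMultiplication.OmegaCensus.C2SemidirectZ4Law
import HarnessLib

/-!
# Dicyclic type with `|A| = 40` and `A/⟨c₀⟩` non-cyclic: `V ≤ 96`; `β(C₂ × (ℤ_n ⋊ ℤ₄))` for every even `n ≥ 6`

ω-census, family (b3).  Framing: lottery ticket; floor = certified bounds/negative ranges.

`tpp_volume_dicyclic_40_le`: in a dicyclic-type group `G(A, c₀)` (`c₀ ≠ 0`) with `|A| = 40` and `A/⟨c₀⟩` NOT cyclic,
every TPP triple has `|S||T||U| ≤ 96 = law − 8`: the law `104` forces a cyclic quotient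
(`quot_cyclic_of_mod_one_law_of_c0_ne_zero`), `98` is `no_98_of_c0_ne_zero`, and `100` is a two-domino or P5 shape
(`shape40_of_vertex_bounds`; `quot_cyclic_of_two_two_sub_four`, `no_sub_four_P5_of_c0_ne_zero`).  This is the abstract
form of `c2_quaternion_40_law` and covers the two other order-80 groups of this kind, `C₂ × (ℤ₁₀ ⋊ ℤ₄)` and
`C₂² × Q₂₀`.  `c2_product_presentation`: `C₂ × G(A, c₀) = G(ℤ₂ × A, (0, c₀))`.  Corollary `c2_semidirect_law_ge_six`:
**`β(C₂ × (ℤ_n ⋊ ℤ₄)) = 16⌊2n/3⌋` for every even `n ≥ 6`** (`c2_semidirect_law` had `n ≥ 14`).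
-/

namespace Summit.MatrixMultiplication.OmegaCensus

open Literature.Combinatorics.Additive Finset

section DihedralLike

variable {A : Type*} [AddCommGroup A] [DecidableEq A] [Fintype A] {G : Type} [Group G] [DecidableEq G]
  {ρ τ : A → G} {c₀ : A} {S T U : Finset G}

/-- **Dicyclic type, `|A| = 40`, `A/⟨c₀⟩` not cyclic ⇒ `|S||T||U| ≤ 96`.** [folklore] -/
theorem tpp_volume_dicyclic_40_le
    (hρρ : ∀ a b, ρ a * ρ b = ρ (a + b)) (hρτ : ∀ a b, ρ a * τ b = τ (b - a))
    (hτρ : ∀ a b, τ a * ρ b = τ (a + b)) (hττ : ∀ a b, τ a * τ b = ρ (c₀ + b - a)) (hc₀ : c₀ ≠ 0)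
    (hnq : ¬ ∃ g : A, ∀ x : A, x ∈ AddSubgroup.zmultiples g ∨ x + c₀ ∈ AddSubgroup.zmultiples g)
    (hρ : Function.Injective ρ) (hτ : Function.Injective τ) (hne : ∀ a b, ρ a ≠ τ b)
    (hsurj : ∀ g, (∃ a, ρ a = g) ∨ (∃ a, τ a = g)) (hA : Fintype.card A = 40) (h : TripleProductProperty S T U) :
    S.card * T.card * U.card ≤ 96 := by
  have hmod : Fintype.card A % 3 = 1 := by rw [hA]
  have hA14 : 14 ≤ Fintype.card A := by rw [hA]; norm_num
  rcases tpp_volume_mod_one_gap hρρ hρτ hτρ hττ hρ hτ hne hsurj hmod hA14 h with hlaw | hgap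
  · exact (hnq (quot_cyclic_of_mod_one_law_of_c0_ne_zero hρρ hρτ hτρ hττ hc₀ hρ hτ hne hsurj hmod hA14 h hlaw)).elim
  rw [hA] at hgap
  by_contra hgt
  push Not at hgt
  obtain ⟨h000, h111, h100, h011, h010, h101, h001, h110⟩ := vertex_counting' hρρ hρτ hτρ hττ hρ hτ hne h
  rw [hA] at h000 h111 h100 h011 h010 h101 h001 h110
  have cS := card_eq_parts' hρ hτ hne hsurj S
  have cT := card_eq_parts' hρ hτ hne hsurj T
  have cU := card_eq_parts' hρ hτ hne hsurj U
  set s₀ := (univ.filter fun a : A => ρ a ∈ S).card with hs₀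
  set s₁ := (univ.filter fun a : A => τ a ∈ S).card with hs₁
  set t₀ := (univ.filter fun a : A => ρ a ∈ T).card with ht₀
  set t₁ := (univ.filter fun a : A => τ a ∈ T).card with ht₁
  set u₀ := (univ.filter fun a : A => ρ a ∈ U).card with hu₀
  set u₁ := (univ.filter fun a : A => τ a ∈ U).card with hu₁
  have hlo : 97 ≤ (s₀ + s₁) * (t₀ + t₁) * (u₀ + u₁) := by rw [← cS, ← cT, ← cU]; omega
  have hhi : (s₀ + s₁) * (t₀ + t₁) * (u₀ + u₁) ≤ 103 := by rw [← cS, ← cT, ← cU]; omega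
  rcases shape40_of_vertex_bounds s₀ s₁ t₀ t₁ u₀ u₁ h000 h111 h100 h011 h010 h101 h001 h110 hlo hhi with
    h98 | ⟨h100', hsh⟩
  · exact no_98_of_c0_ne_zero hρρ hρτ hτρ hττ hc₀ hρ hτ hne hA h
      (shape98_of_vertex_bounds _ _ _ _ _ _ h000 h111 h100 h011 h010 h101 h001 h110 h98)
  have hV : 3 * (S.card * T.card * U.card) + 20 = 8 * Fintype.card A := by rw [cS, cT, cU, h100', hA]
  have hV_TUS : 3 * (T.card * U.card * S.card) + 20 = 8 * Fintype.card A := by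
    rw [show T.card * U.card * S.card = S.card * T.card * U.card by ring]; exact hV
  have hV_UST : 3 * (U.card * S.card * T.card) + 20 = 8 * Fintype.card A := by
    rw [show U.card * S.card * T.card = S.card * T.card * U.card by ring]; exact hV
  have hV_SUT : 3 * (S.card * U.card * T.card) + 20 = 8 * Fintype.card A := by
    rw [show S.card * U.card * T.card = S.card * T.card * U.card by ring]; exact hV
  have hV_TSU : 3 * (T.card * S.card * U.card) + 20 = 8 * Fintype.card A := by
    rw [show T.card * S.card * U.card = S.card * T.card * U.card by ring]; exact hV
  have hV_UTS : 3 * (U.card * T.card * S.card) + 20 = 8 * Fintype.card A := by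
    rw [show U.card * T.card * S.card = S.card * T.card * U.card by ring]; exact hV
  have five : ∀ {d e : ℕ}, d * e = 5 → (d = 1 ∧ e = 5) ∨ (d = 5 ∧ e = 1) := by
    intro d e hde
    have hd : d ∣ 5 := ⟨e, hde.symm⟩
    have hd5 : d ≤ 5 := Nat.le_of_dvd (by norm_num) hd
    interval_cases d <;> omega
  rcases hsh with ⟨et, eu, hp⟩ | ⟨es, eu, hp⟩ | ⟨es, et, hp⟩
  · rcases hp with hp | ⟨hp, hδ⟩
    · have ht := Nat.eq_one_of_mul_eq_one_right hp
      have hu := Nat.eq_one_of_mul_eq_one_left hp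
      exact hnq (quot_cyclic_of_two_two_sub_four hρρ hρτ hτρ hττ hc₀ hρ hτ hne hsurj hmod hA14 h.rotate
        ht (by omega) hu (by omega) hV_TUS)
    · rcases five hp with ⟨hd, he⟩ | ⟨hd, he⟩
      · exact no_sub_four_P5_of_c0_ne_zero hρρ hρτ hτρ hττ hc₀ hρ hτ hne hsurj h hδ hd (by omega) he (by omega) hV
      · exact no_sub_four_P5_of_c0_ne_zero hρρ hρτ hτρ hττ hc₀ hρ hτ hne hsurj (tpp_reverse h.rotate) hδ he
          (by omega) hd (by omega) hV_SUT
  · rcases hp with hp | ⟨hp, hδ⟩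
    · have hs := Nat.eq_one_of_mul_eq_one_right hp
      have hu := Nat.eq_one_of_mul_eq_one_left hp
      exact hnq (quot_cyclic_of_two_two_sub_four hρρ hρτ hτρ hττ hc₀ hρ hτ hne hsurj hmod hA14 h.rotate.rotate
        hu (by omega) hs (by omega) hV_UST)
    · rcases five hp with ⟨hd, he⟩ | ⟨hd, he⟩
      · exact no_sub_four_P5_of_c0_ne_zero hρρ hρτ hτρ hττ hc₀ hρ hτ hne hsurj (tpp_reverse h.rotate.rotate) hδ hd
          (by omega) he (by omega) hV_TSU
      · exact no_sub_four_P5_of_c0_ne_zero hρρ hρτ hτρ hττ hc₀ hρ hτ hne hsurj h.rotate hδ he (by omega) hd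
          (by omega) hV_TUS
  · rcases hp with hp | ⟨hp, hδ⟩
    · have hs := Nat.eq_one_of_mul_eq_one_right hp
      have ht := Nat.eq_one_of_mul_eq_one_left hp
      exact hnq (quot_cyclic_of_two_two_sub_four hρρ hρτ hτρ hττ hc₀ hρ hτ hne hsurj hmod hA14 h
        hs (by omega) ht (by omega) hV)
    · rcases five hp with ⟨hd, he⟩ | ⟨hd, he⟩
      · exact no_sub_four_P5_of_c0_ne_zero hρρ hρτ hτρ hττ hc₀ hρ hτ hne hsurj h.rotate.rotate hδ hd (by omega) he
          (by omega) hV_UST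
      · exact no_sub_four_P5_of_c0_ne_zero hρρ hρτ hτρ hττ hc₀ hρ hτ hne hsurj (tpp_reverse h) hδ he (by omega) hd
          (by omega) hV_UTS

omit [DecidableEq A] [Fintype A] [DecidableEq G] in
/-- **`C₂ × G(A, c₀) = G(ℤ₂ × A, (0, c₀))`**: a presentation of `G` by `(ρ, τ, c₀)` induces one of
`Multiplicative (ZMod 2) × G`, packaged. [folklore] -/
theorem c2_product_presentation
    (hρρ : ∀ a b, ρ a * ρ b = ρ (a + b)) (hρτ : ∀ a b, ρ a * τ b = τ (b - a))
    (hτρ : ∀ a b, τ a * ρ b = τ (a + b)) (hττ : ∀ a b, τ a * τ b = ρ (c₀ + b - a))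
    (hρ : Function.Injective ρ) (hτ : Function.Injective τ) (hne : ∀ a b, ρ a ≠ τ b)
    (hsurj : ∀ g, (∃ a, ρ a = g) ∨ (∃ a, τ a = g)) {P : Prop}
    (K : ∀ (ρ' τ' : ZMod 2 × A → Multiplicative (ZMod 2) × G) (c₀' : ZMod 2 × A),
      (∀ a b, ρ' a * ρ' b = ρ' (a + b)) → (∀ a b, ρ' a * τ' b = τ' (b - a)) → (∀ a b, τ' a * ρ' b = τ' (a + b)) →
      (∀ a b, τ' a * τ' b = ρ' (c₀' + b - a)) → Function.Injective ρ' → Function.Injective τ' →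
      (∀ a b, ρ' a ≠ τ' b) → (∀ g, (∃ a, ρ' a = g) ∨ (∃ a, τ' a = g)) → c₀' = ((0 : ZMod 2), c₀) → P) : P :=
  K (fun p => (Multiplicative.ofAdd p.1, ρ p.2)) (fun p => (Multiplicative.ofAdd p.1, τ p.2)) ((0 : ZMod 2), c₀)
    (fun a b => by simp only [Prod.mk_mul_mk, hρρ, ← ofAdd_add, Prod.fst_add, Prod.snd_add])
    (fun a b => by
      simp only [Prod.mk_mul_mk, hρτ, ← ofAdd_add, Prod.fst_sub, Prod.snd_sub]
      rw [sub_eq_add_neg b.1, ZMod.neg_eq_self_mod_two, add_comm b.1])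
    (fun a b => by simp only [Prod.mk_mul_mk, hτρ, ← ofAdd_add, Prod.fst_add, Prod.snd_add])
    (fun a b => by
      simp only [Prod.mk_mul_mk, hττ, ← ofAdd_add, Prod.fst_sub, Prod.snd_sub, Prod.fst_add, Prod.snd_add, zero_add]
      rw [sub_eq_add_neg b.1, ZMod.neg_eq_self_mod_two, add_comm b.1])
    (fun a b hab => by
      simp only [Prod.mk.injEq] at hab
      exact Prod.ext (Multiplicative.ofAdd.injective hab.1) (hρ hab.2))
    (fun a b hab => by
      simp only [Prod.mk.injEq] at hab
      exact Prod.ext (Multiplicative.ofAdd.injective hab.1) (hτ hab.2))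
    (fun a b hab => by
      simp only [Prod.mk.injEq] at hab
      exact hne _ _ hab.2)
    (fun g => by
      obtain ⟨i, x⟩ := g
      rcases hsurj x with ⟨a, ha⟩ | ⟨a, ha⟩
      · exact Or.inl ⟨(Multiplicative.toAdd i, a), by simp [ha]⟩
      · exact Or.inr ⟨(Multiplicative.toAdd i, a), by simp [ha]⟩)
    rfl

end DihedralLike

section C2SD

variable {n : ℕ} [NeZero n]

/-- **`β(C₂ × (ℤ_n ⋊ ℤ₄)) = 16⌊2n/3⌋` for every even `n ≥ 6`** (kernel): `c2_semidirect_law` for `n ≥ 14`, the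
dicyclic law / general law for `n = 8 / 6, 12`, and `tpp_volume_dicyclic_40_le` for `n = 10`. [folklore] -/
theorem c2_semidirect_law_ge_six (hn2 : 2 ∣ n) (hn : 6 ≤ n) :
    (∀ S T U : Finset (Multiplicative (ZMod 2) × DihedralLikeGroup (ZMod 2 × ZMod n) ((1 : ZMod 2), 0)),
        TripleProductProperty S T U → S.card * T.card * U.card ≤ 16 * (2 * n / 3)) ∧
    ∃ S T U : Finset (Multiplicative (ZMod 2) × DihedralLikeGroup (ZMod 2 × ZMod n) ((1 : ZMod 2), 0)),
      TripleProductProperty S T U ∧ S.card * T.card * U.card = 16 * (2 * n / 3) := by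
  by_cases h14 : 14 ≤ n
  · exact c2_semidirect_law hn2 h14
  refine ⟨fun S T U h => ?_, c2_semidirect_volume_ge (by omega)⟩
  obtain ⟨hc₀, hnq⟩ := z2_z2_zn_quot_noncyclic (n := n) hn2
  refine c2_semidirect_presentation (n := n) fun ρ τ c₀ hρρ hρτ hτρ hττ hρ hτ hne hsurj hc => ?_
  subst hc
  have hcard : Fintype.card (ZMod 2 × (ZMod 2 × ZMod n)) = 4 * n := by
    rw [Fintype.card_prod, Fintype.card_prod, ZMod.card, ZMod.card]; ring
  have h2c := two_c0_eq_zero hρτ hτρ hττ hτ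
  by_cases h10 : n = 10
  · subst h10
    have key := tpp_volume_dicyclic_40_le hρρ hρτ hτρ hττ hc₀ hnq hρ hτ hne hsurj (by rw [hcard]) h
    omega
  by_cases h8 : n = 8
  · subst h8
    have key := tpp_volume_le_law_dicyclicLike hρρ hρτ hτρ hττ hρ hτ hne hsurj h2c hc₀ (by rw [hcard])
      (by rw [hcard]; norm_num) h
    rw [hcard] at key
    omega
  have h3 : 3 ∣ n := by omega
  have key := tpp_volume_le_of_dihedralLike hρρ hρτ hτρ hττ hρ hτ hne hsurj h
  rw [hcard] at key
  omega

end C2SD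

end Summit.MatrixMultiplication.OmegaCensus
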